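import Summits.BirchSwinnertonDyer.BirchSwinnertonDyer.Theorems.ErratumRoadFiveTwoVariableControlDual
import HarnessLib

/-!
# Two-variable CONTROL with FINITE defect ([JSW17, Lemma 3.4.1]), Pontryagin-dual side: from an injective
# `C`-semilinear `θ : N₁ ↪ N₂[r]` of FINITE INDEX to `N₂^∨/r ↠ N₁^∨` with FINITE kernel
# (pure algebra; helper, `--supports stmt-BirchSwinnertonDyer-25505`)

Cell `bsd-stepL`, seat `bsd-stepL-imc-p1` (prover g22, 2026-08-28). Theorems only (no definition, no named fact, no
`sorry`, no instance, no notation). The algebraic half of the v4 stub `stub_controlAnomalous` of line `erratum_chain`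
of crux 25505 `ErratumThm23SigmaLe` (memo `HOME/imc-p1/g22/CORNER-25505-imc-p1-g22.md` §2, §4(b)(i)): imc-p1 g21's
`ControlDual.exists_quotSMulTop_linearMap` (p618914) treats the EXACT case (`range θ = N₂[r]`, kernel `⊥`); here the
range is only of FINITE INDEX in `N₂[r]` — the shape of the control at the anomalous corner `¬(dec)`, where the
cokernel of `Sel_ac(M) ↪ Sel_K(𝓜)[T_c]` is a quotient of the FINITE local defect `𝓜^{G_{K_𝔭̄}}/T_c` — and the
conclusion is a surjection `f : N₂^∨/r → N₁^∨` with FINITE kernel ("has finite order", [JSW17, Lemma 3.4.1]); over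
`Λ_𝒪 = 𝒪⟦T⟧` a finite kernel is pseudo-null (tree `…CharIdealBaseChange.isPseudoNull_of_finite`), which is what the
descent `TwoVariableDescent.charIdeal_le_map_constantCoeff_of_control` consumes.

## What is proved

Data: `C : R →+* S`, `r ∈ S`, an `R`-module `N₁`, an `S`-module `N₂`, an additive injective `θ : N₁ → N₂` with
`θ (a • n) = C a • θ n` and `r • θ n = 0` (so `range θ ≤ N₂[r]`), and FINITE INDEX: the quotient of the additive group
`N₂[r] = torsionBy S N₂ r` by (the trace of) `range θ` is finite.

* `exists_quotSMulTop_linearMap_of_finite_index` — there is an `R`-linear `f : QuotSMulTop r (CharacterModule N₂) →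
  CharacterModule N₁` (the quotient an `R`-module through `C`) with `f [χ] = χ ∘ θ`, SURJECTIVE (`ℚ/ℤ` divisible), whose
  KERNEL IS FINITE: `[χ] ∈ ker f` iff `χ` kills `range θ`; then `χ|_{N₂[r]}` factors through the finite
  `Q = N₂[r]/range θ`, and `[χ] ↦ χ|_{N₂[r]}` (a map `ker f → Hom(Q, ℚ/ℤ)`, finite target) is injective because a
  character killing ALL of `N₂[r]` is an `r`-multiple (`SkinnerUrban2014.exists_smul_eq_of_forall_apply_eq_zero`).
* `module_finite_characterModule_of_finite_index` — if moreover `S` is `(r)`-adically (pre)complete, `N₂` is `r`-power torsion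
  and `N₁^∨` is finitely generated over `R`, then `N₂^∨` is finitely generated over `S` (`N₂^∨/r` is an extension of `N₁^∨` by
  the finite kernel, hence finitely generated; complete Nakayama lifts generators) — g21's `module_finite_characterModule`
  without exactness.

HONEST FRAMING: module algebra; nothing about any newform or curve is asserted; BSD is proved for no pair; closes: none (T7).

## References
* [JetchevSkinnerWan2017] §3.4, Lemma 3.4.1 and the display before it (arXiv:1512.06894 p. 14: "of finite order", "so, too, is the kernel").
* [Washington1997] Lemma 13.16; [GreenbergLNM1716] §4, proof of Prop. 4.10.
-/

noncomputable section

-- D-0017: single-problem summit, the namespace repeats the problem name by design.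
set_option linter.dupNamespace false
set_option autoImplicit false

namespace Summit.BirchSwinnertonDyer.BirchSwinnertonDyer.Theorems.ErratumThm23TwoVariable.ControlDualFinite

open Literature.NumberTheory.EllipticCurves
open scoped Pointwise

variable {R S : Type*} [CommRing R] [CommRing S] (C : R →+* S) (r : S)
  {N₁ N₂ : Type*} [AddCommGroup N₁] [Module R N₁] [AddCommGroup N₂] [Module S N₂]
  (θ : N₁ →+ N₂)

/-- **Pontryagin dual of a control injection of FINITE INDEX: `N₂^∨/r N₂^∨ ↠ N₁^∨` with FINITE kernel.** For an
additive, injective, `C`-semilinear `θ : N₁ → N₂` with `r • θ = 0` whose range has finite index in `N₂[r]`, there is an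
`R`-linear `f : QuotSMulTop r (CharacterModule N₂) → CharacterModule N₁` (the quotient an `R`-module through `C`) with
`f [χ] = χ ∘ θ`, SURJECTIVE, with `ker f` FINITE (it embeds into `Hom(N₂[r]/range θ, ℚ/ℤ)`) — the map
"`X(𝓜)/(γ₊ − 1)X(𝓜) ↠ X(M)`" of [JSW17] when the control defect is finite but not zero.
[cite: JetchevSkinnerWan2017, §3.4, Lemma 3.4.1 (arXiv:1512.06894 p. 14)]
[cite: Washington1997, Lemma 13.16 (X/TX for the Pontryagin dual X)] -/
theorem exists_quotSMulTop_linearMap_of_finite_index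
    (hθC : ∀ (a : R) (n : N₁), θ (a • n) = C a • θ n) (hθr : ∀ n : N₁, r • θ n = 0)
    (hinj : Function.Injective θ)
    (hfin : Finite (↥(Submodule.torsionBy S N₂ r).toAddSubgroup ⧸
      (θ.range).addSubgroupOf (Submodule.torsionBy S N₂ r).toAddSubgroup)) :
    ∃ f : (letI : Module R (QuotSMulTop r (CharacterModule N₂)) := Module.compHom _ C
          QuotSMulTop r (CharacterModule N₂) →ₗ[R] CharacterModule N₁),
      Function.Surjective f ∧
      (∀ χ : CharacterModule N₂, f (Submodule.Quotient.mk χ) = χ.comp θ) ∧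
      (letI : Module R (QuotSMulTop r (CharacterModule N₂)) := Module.compHom _ C
       Finite (LinearMap.ker f)) := by
  classical
  letI : Module R (QuotSMulTop r (CharacterModule N₂)) := Module.compHom _ C
  -- the dual `χ ↦ χ ∘ θ` kills `r • N₂^∨`
  let f₀ : CharacterModule N₂ →+ CharacterModule N₁ :=
    { toFun := fun χ ↦ χ.comp θ
      map_zero' := rfl
      map_add' := fun _ _ ↦ rfl }
  have hf₀ : ∀ χ ∈ (r • (⊤ : Submodule S (CharacterModule N₂))).toAddSubgroup, f₀ χ = 0 := by
    intro χ hχ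
    rw [Submodule.mem_toAddSubgroup, Submodule.mem_smul_pointwise_iff_exists] at hχ
    obtain ⟨ψ, -, rfl⟩ := hχ
    ext n
    change (r • ψ) (θ n) = 0
    rw [CharacterModule.smul_apply, hθr, map_zero]
  let f₁ : QuotSMulTop r (CharacterModule N₂) →+ CharacterModule N₁ :=
    QuotientAddGroup.lift _ f₀ hf₀
  have hf₁ : ∀ χ : CharacterModule N₂, f₁ (Submodule.Quotient.mk χ) = χ.comp θ := fun _ ↦ rfl
  -- `R`-linearity through `C`
  let f : QuotSMulTop r (CharacterModule N₂) →ₗ[R] CharacterModule N₁ :=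
    { toFun := f₁
      map_add' := map_add f₁
      map_smul' := fun a q ↦ by
        induction q using Submodule.Quotient.induction_on with
        | H χ =>
          change f₁ (Submodule.Quotient.mk (C a • χ)) = a • f₁ (Submodule.Quotient.mk χ)
          rw [hf₁, hf₁]
          ext n
          change (C a • χ) (θ n) = χ (θ (a • n))
          rw [CharacterModule.smul_apply, hθC] }
  have hf : ∀ χ : CharacterModule N₂, f (Submodule.Quotient.mk χ) = χ.comp θ := hf₁
  refine ⟨f, ?_, hf, ?_⟩
  · -- surjective: extend `ψ ∘ θ⁻¹` along the injection `θ` (`ℚ/ℤ` is divisible)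
    intro ψ
    obtain ⟨χ, hχ⟩ := CharacterModule.dual_surjective_of_injective θ.toIntLinearMap hinj ψ
    exact ⟨Submodule.Quotient.mk χ, by rw [hf]; exact hχ⟩
  · -- finite kernel: `[χ] ↦ χ|_{N₂[r]}`, a map on `N₂[r]/range θ` (finite), is injective on `ker f`
    set T : AddSubgroup N₂ := (Submodule.torsionBy S N₂ r).toAddSubgroup with hT
    set H : AddSubgroup T := (θ.range).addSubgroupOf T with hH
    haveI : Finite (T ⧸ H) := hfin
    haveI : Finite (CharacterModule (T ⧸ H)) := SkinnerUrban2014.finite_characterModule (T ⧸ H)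
    have hmemT : ∀ y : N₂, y ∈ T ↔ r • y = 0 := fun y ↦ by
      rw [hT, Submodule.mem_toAddSubgroup, Submodule.mem_torsionBy_iff]
    -- a representative of each kernel class, and the induced character of `T/H`
    have hrep : ∀ q : LinearMap.ker f, ∃ χ : CharacterModule N₂,
        Submodule.Quotient.mk χ = (q : QuotSMulTop r (CharacterModule N₂)) ∧ χ.comp θ = 0 := by
      rintro ⟨q, hq⟩
      induction q using Submodule.Quotient.induction_on with
      | H χ => exact ⟨χ, rfl, by rw [LinearMap.mem_ker, hf] at hq; exact hq⟩
    choose rep hrep_mk hrep_ker using hrep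
    have hkill : ∀ (q : LinearMap.ker f) (t : T), t ∈ H → rep q (t : N₂) = 0 := by
      intro q t ht
      rw [hH, AddSubgroup.mem_addSubgroupOf, AddMonoidHom.mem_range] at ht
      obtain ⟨n, hn⟩ := ht
      rw [← hn]
      exact DFunLike.congr_fun (hrep_ker q) n
    let Φ : LinearMap.ker f → CharacterModule (T ⧸ H) := fun q ↦
      QuotientAddGroup.lift H ((rep q).comp T.subtype) (fun t ht ↦ hkill q t ht)
    have hΦ : ∀ (q : LinearMap.ker f) (t : T), Φ q (QuotientAddGroup.mk t) = rep q (t : N₂) :=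
      fun _ _ ↦ rfl
    refine Finite.of_injective Φ fun q₁ q₂ h ↦ ?_
    -- `rep q₁ - rep q₂` kills `N₂[r]`, hence is an `r`-multiple, hence `[rep q₁] = [rep q₂]`
    have hdiff : ∀ y : N₂, r • y = 0 → (rep q₁ - rep q₂) y = 0 := by
      intro y hy
      have e := congrArg (fun (ψ : CharacterModule (T ⧸ H)) ↦ ψ (QuotientAddGroup.mk ⟨y, (hmemT y).2 hy⟩)) h
      simp only [hΦ] at e
      change rep q₁ y - rep q₂ y = 0
      rw [sub_eq_zero]
      exact e
    obtain ⟨ψ, hψ⟩ := SkinnerUrban2014.exists_smul_eq_of_forall_apply_eq_zero r (rep q₁ - rep q₂) hdiff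
    apply Subtype.ext
    rw [← hrep_mk q₁, ← hrep_mk q₂, eq_comm, ← sub_eq_zero, ← Submodule.Quotient.mk_sub, eq_comm]
    refine ((Submodule.Quotient.mk_eq_zero _).2 ?_).symm
    rw [← neg_sub, Submodule.neg_mem_iff]
    exact (Submodule.mem_smul_pointwise_iff_exists _ _ _).2 ⟨ψ, Submodule.mem_top, hψ⟩

/-- **Finite generation of `N₂^∨` over `S` from that of `N₁^∨` over `R`, finite-defect case**: when `S` is
`(r)`-adically (pre)complete, `N₂` is `r`-power torsion and `range θ` has finite index in `N₂[r]`, the surjection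
`N₂^∨/r ↠ N₁^∨` with finite kernel makes `N₂^∨/r` finitely generated (over `R` through `C`, hence over `S`), and the
complete Nakayama lemma (`Literature.Algebra.Module.finite_of_isHausdorff_of_forall_mem_sup`) lifts generators — "[`X^Σ_{Gr}(𝓜)`] is a
finite `Λ_K`-module" ([JSW17, §3.4]) without exact control.
[cite: JetchevSkinnerWan2017, §3.4 (arXiv:1512.06894 p. 14, "a finite Λ_K-module")] [cite: Matsumura1987, Theorem 8.4] -/
theorem module_finite_characterModule_of_finite_index [IsPrecomplete (Ideal.span {r}) S]
    (hθC : ∀ (a : R) (n : N₁), θ (a • n) = C a • θ n) (hθr : ∀ n : N₁, r • θ n = 0)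
    (hinj : Function.Injective θ)
    (hfin : Finite (↥(Submodule.torsionBy S N₂ r).toAddSubgroup ⧸
      (θ.range).addSubgroupOf (Submodule.torsionBy S N₂ r).toAddSubgroup))
    (htors : ∀ y : N₂, ∃ n : ℕ, r ^ n • y = 0)
    [Module.Finite R (CharacterModule N₁)] :
    Module.Finite S (CharacterModule N₂) := by
  classical
  -- `(r)`-adic separatedness of `N₂^∨`
  haveI : IsHausdorff (Ideal.span {r}) (CharacterModule N₂) := by
    refine ⟨fun x hx ↦ ?_⟩
    ext y
    obtain ⟨n, hn⟩ := htors y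
    have hxn := hx n
    rw [SModEq.zero, Ideal.span_singleton_pow, Submodule.ideal_span_singleton_smul,
      Submodule.mem_smul_pointwise_iff_exists] at hxn
    obtain ⟨z, -, rfl⟩ := hxn
    rw [CharacterModule.smul_apply, hn, map_zero]
    rfl
  obtain ⟨f, hfs, hf, hker⟩ := exists_quotSMulTop_linearMap_of_finite_index C r θ hθC hθr hinj hfin
  letI : Module R (QuotSMulTop r (CharacterModule N₂)) := Module.compHom _ C
  haveI : Finite (LinearMap.ker f) := hker
  -- `N₂^∨/r` is finitely generated over `R` (extension of `N₁^∨` by the finite kernel)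
  haveI : Module.Finite R (LinearMap.ker f) := Module.Finite.of_finite
  haveI : Module.Finite R (QuotSMulTop r (CharacterModule N₂) ⧸ LinearMap.ker f) :=
    Module.Finite.equiv (f.quotKerEquivOfSurjective hfs).symm
  haveI hfgR : Module.Finite R (QuotSMulTop r (CharacterModule N₂)) :=
    Module.Finite.of_submodule_quotient (LinearMap.ker f)
  obtain ⟨t, ht⟩ := Module.Finite.fg_top (R := R) (M := QuotSMulTop r (CharacterModule N₂))
  -- representatives of the generators
  have hlift : ∀ q : QuotSMulTop r (CharacterModule N₂), ∃ χ : CharacterModule N₂, Submodule.Quotient.mk χ = q := by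
    intro q
    induction q using Submodule.Quotient.induction_on with
    | H χ => exact ⟨χ, rfl⟩
  choose lift hlift using hlift
  refine Literature.Algebra.Module.finite_of_isHausdorff_of_forall_mem_sup (Ideal.span {r})
    (fun i : t ↦ lift (i : QuotSMulTop r (CharacterModule N₂))) fun m ↦ ?_
  -- write `[m]` on the generators (coefficients in `R`, acting through `C`) and lift the combination
  have hm : Submodule.Quotient.mk (p := r • (⊤ : Submodule S (CharacterModule N₂))) m ∈
      Submodule.span R (t : Set (QuotSMulTop r (CharacterModule N₂))) := by
    rw [ht]; exact Submodule.mem_top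
  obtain ⟨c, hc⟩ := Submodule.mem_span_finset'.1 hm
  set m₀ : CharacterModule N₂ := ∑ a : t, C (c a) • lift (a : QuotSMulTop r (CharacterModule N₂)) with hm₀
  have hm₀mem : m₀ ∈ Submodule.span S (Set.range fun i : t ↦ lift (i : QuotSMulTop r (CharacterModule N₂))) :=
    Submodule.sum_mem _ fun a _ ↦ Submodule.smul_mem _ _ (Submodule.subset_span ⟨a, rfl⟩)
  have hmk : Submodule.Quotient.mk (p := r • (⊤ : Submodule S (CharacterModule N₂))) m₀ =
      Submodule.Quotient.mk (p := r • (⊤ : Submodule S (CharacterModule N₂))) m := by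
    rw [← hc, hm₀, ← Submodule.mkQ_apply, map_sum]
    refine Finset.sum_congr rfl fun a _ ↦ ?_
    rw [Submodule.mkQ_apply, Submodule.Quotient.mk_smul, hlift]
    rfl
  -- `[m] = [m₀]`, i.e. `m - m₀ ∈ r • N₂^∨`
  have hdiff : Submodule.Quotient.mk (p := r • (⊤ : Submodule S (CharacterModule N₂))) (m - m₀) = 0 := by
    rw [Submodule.Quotient.mk_sub, hmk, sub_self]
  rw [Submodule.Quotient.mk_eq_zero] at hdiff
  rw [Submodule.ideal_span_singleton_smul]
  exact Submodule.mem_sup.2 ⟨m₀, hm₀mem, m - m₀, hdiff, add_sub_cancel m₀ m⟩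

end Summit.BirchSwinnertonDyer.BirchSwinnertonDyer.Theorems.ErratumThm23TwoVariable.ControlDualFinite

end
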